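import Summits.NavierStokesRegularity.NavierStokesRegularity.Theorems.FilamentSkeletonRssKelvinGateOrderOne

/-!
# Route `FilamentSkeletonRss` · crux `TransverseReductionRJ` (stmt-NavierStokesRegularity-21221) — line `kelvin_gate` v4,
# stub S2′ `EventualKelvinGate`: NORMAL FORM (one order, unit residual constant, all constants existential up front)

Helper file (theorems only, `--supports stmt-NavierStokesRegularity-21221 --as helper`), in the vocabulary of
`FilamentSkeletonRssKelvinGateDefs` (§5, v4 statements) / `…Tools` / `…OrderOne`.  HONEST FRAMING: bookkeeping for a
HYPOTHETICAL filament-type RSS blow-up route; nothing here bears on Navier–Stokes regularity; no stub is proved here.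

The registered v4 stub S2′ reads `∀ Cs, ∃ κ C₂, ∃ k₀, ∀ k, k₀ ≤ k → 1 ≤ k → ∀ Cr, ∃ Γ₁, ∀ Γ ≥ Γ₁, … BaseSpec(k, Cs, Cr) → ∃ gate(κ, C₂)`.
Because `BaseSpec` is monotone in its residual budget `Cr · Γ^{-k}` (`BaseSpec.of_residual_le`, file `…OrderOne`) and
the threshold `k₀` is the gate's to choose, both inner universal quantifiers can be traded for ONE unit of dressing order:

* `BaseSpec.order_drop_unit` — a base family of order `k ≥ k₀ + 1` with residual constant `Cr` is a base family of order
  `k₀` with residual constant `1` once `Γ ≥ max(1, Cr)` (`Cr Γ^{-k} ≤ Cr Γ^{-1} Γ^{-k₀} ≤ Γ^{-k₀}`);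
* `eventualKelvinGate_iff_unit` — **S2′ is EQUIVALENT to: `∀ Cs, ∃ κ C₂ k₀ Γ₁, ∀ Γ ≥ Γ₁`, every box datum and every base
  family with `Y(r_p) ≤ Γ^{-k₀}` (order `k₀`, residual constant `1`) admits a gate with constants `(κ, C₂)`.**
  So an S2′ prover names four numbers `(κ, C₂, k₀, Γ₁)` depending on the box constants and `Cs` only, and proves ONE
  gate statement about `Γ^{-k₀}`-exact bases; no `∀ k`, no `∀ Cr`.  (Contrast v3, where `polynomialKelvinGate_iff_order_one`
  pins the order at `1` with `Cr` still universal — the shape shown to be generically false in evidence #22.)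
-/

set_option linter.dupNamespace false

noncomputable section

namespace Summit.NavierStokesRegularity.NavierStokesRegularity.Theorems.KelvinGate

open Set Function
open Literature.Analysis.FluidPDE
open scoped InnerProductSpace Laplacian ContDiff Topology

/-- **Dropping one order absorbs the residual constant** (`Γ ≥ 1`, `Γ ≥ Cr`): a base family of order `k ≥ k₀ + 1` with
residual constant `Cr` is a base family of order `k₀` with residual constant `1`, since
`Cr Γ^{-k} ≤ Cr Γ^{-(k₀+1)} = (Cr Γ^{-1}) Γ^{-k₀} ≤ Γ^{-k₀}`. -/
theorem BaseSpec.order_drop_unit {N : ℕ} {Γ ρ η Rw : ℝ} {k k₀ : ℕ} {Cs Cr : ℝ} {α : (Fin N → ℝ) → ℝ}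
    {X : (Fin N → ℝ) → Fin N → ℝ → EuclideanSpace ℝ (Fin 3)}
    {u : (Fin N → ℝ) → (Fin N → ℝ → EuclideanSpace ℝ (Fin 3)) → EuclideanSpace ℝ (Fin 3) → EuclideanSpace ℝ (Fin 3)}
    {D : (Fin N → ℝ) → Fin N → EuclideanSpace ℝ (Fin 3) → EuclideanSpace ℝ (Fin 3)}
    {U0 : (Fin N → ℝ) → EuclideanSpace ℝ (Fin 3) → EuclideanSpace ℝ (Fin 3)} {P0 : (Fin N → ℝ) → EuclideanSpace ℝ (Fin 3) → ℝ}
    {b0 : (Fin N → ℝ) → Fin N → ℝ} (h : BaseSpec N Γ ρ η Rw k Cs Cr α X u D U0 P0 b0)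
    (hΓ : 1 ≤ Γ) (hΓCr : Cr ≤ Γ) (hk : k₀ + 1 ≤ k) :
    BaseSpec N Γ ρ η Rw k₀ Cs 1 α X u D U0 P0 b0 := by
  have hCr : 0 ≤ Cr := (BaseSpec.pos (by linarith) h).2
  have hΓ0 : 0 < Γ := by linarith
  refine h.of_residual_le ?_
  have hk' : (-(k:ℝ)) ≤ -((k₀:ℝ) + 1) := by
    have : ((k₀:ℝ) + 1) ≤ k := by exact_mod_cast hk
    linarith
  calc Cr * Γ ^ (-(k:ℝ)) ≤ Cr * Γ ^ (-((k₀:ℝ) + 1)) :=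
        mul_le_mul_of_nonneg_left (Real.rpow_le_rpow_of_exponent_le hΓ hk') hCr
    _ = (Cr * Γ ^ (-(1:ℝ))) * Γ ^ (-(k₀:ℝ)) := by
        rw [show (-((k₀:ℝ) + 1)) = (-(1:ℝ)) + (-(k₀:ℝ)) by ring, Real.rpow_add hΓ0]; ring
    _ ≤ 1 * Γ ^ (-(k₀:ℝ)) := by
        refine mul_le_mul_of_nonneg_right ?_ (Real.rpow_nonneg hΓ0.le _)
        rw [Real.rpow_neg hΓ0.le, Real.rpow_one]
        calc Cr * Γ⁻¹ ≤ Γ * Γ⁻¹ := mul_le_mul_of_nonneg_right hΓCr (inv_nonneg.mpr hΓ0.le)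
          _ = 1 := mul_inv_cancel₀ hΓ0.ne'

/-- **Normal form of stub S2′ (`EventualKelvinGate`).**  The stub is EQUIVALENT to: for every admissible parameter tuple
and size constant `Cs` there are `κ, C₂, k₀, Γ₁` such that for all `Γ ≥ Γ₁`, every box datum and every base family of
order `k₀` with residual constant `1` (`Y(r_p) ≤ Γ^{-k₀}`) admits a Kelvin gate with constants `(κ, C₂)`.
(`→`: specialise `k := max k₀ 1`, `Cr := 1`.  `←`: answer with threshold `k₀ + 1`; for `k ≥ k₀ + 1`, `Cr`, take
`Γ ≥ max(Γ₁, 1, Cr)` and use `BaseSpec.order_drop_unit`.) -/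
theorem eventualKelvinGate_iff_unit :
    EventualKelvinGate ↔
    ∀ (N : ℕ) (δ ρ K Λ a b cnd η Rw Rb cg θ₀ : ℝ), 0 < N → 0 < δ → 0 < ρ → 0 ≤ a → 0 < η → 0 < Rw → 0 < Rb → 0 < cg → 0 < θ₀ →
    ∀ Cs : ℝ, ∃ κ C₂ : ℝ, ∃ k₀ : ℕ, ∃ Γ₁ : ℝ, ∀ Γ : ℝ, Γ₁ ≤ Γ → ∀ (γ : (Fin N → ℝ) → Fin N → ℝ) (α : (Fin N → ℝ) → ℝ) (X : (Fin N → ℝ) → Fin N → ℝ → EuclideanSpace ℝ (Fin 3)) (w : (Fin N → ℝ) → Fin N → ℝ → ℝ) (c : (Fin N → ℝ) → Fin N → ℝ) (m : (Fin N → ℝ) → Fin N → EuclideanSpace ℝ (Fin 3)) (n : (Fin N → ℝ) → Fin N → EuclideanSpace ℝ (Fin 3)) (u : (Fin N → ℝ) → (Fin N → ℝ → EuclideanSpace ℝ (Fin 3)) → EuclideanSpace ℝ (Fin 3) → EuclideanSpace ℝ (Fin 3)) (v : (Fin N → ℝ) → EuclideanSpace ℝ (Fin 3) → EuclideanSpace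 ℝ (Fin 3)) (A : (Fin N → ℝ) → Fin N → (EuclideanSpace ℝ (Fin 3) →L[ℝ] EuclideanSpace ℝ (Fin 3))) (T : (Fin N → ℝ) → (Fin N → ℝ → EuclideanSpace ℝ (Fin 3)) → Fin N → ℝ → EuclideanSpace ℝ (Fin 3)) (D : (Fin N → ℝ) → Fin N → EuclideanSpace ℝ (Fin 3) → EuclideanSpace ℝ (Fin 3)),
      DefU N Γ γ u → DefV N α X u v → DefA N X c v A → DefT N α u T → DefD N X c D → BoxClausesJ N Γ δ ρ K Λ a b cnd Rw Rb cg θ₀ γ α X w c m n v A T →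
      ∀ (U0 : (Fin N → ℝ) → EuclideanSpace ℝ (Fin 3) → EuclideanSpace ℝ (Fin 3)) (P0 : (Fin N → ℝ) → EuclideanSpace ℝ (Fin 3) → ℝ) (b0 : (Fin N → ℝ) → Fin N → ℝ), BaseSpec N Γ ρ η Rw k₀ Cs 1 α X u D U0 P0 b0 →
      ∃ (𝓚 : (Fin N → ℝ) → (EuclideanSpace ℝ (Fin 3) → EuclideanSpace ℝ (Fin 3)) → EuclideanSpace ℝ (Fin 3) → EuclideanSpace ℝ (Fin 3)) (𝓠 : (Fin N → ℝ) → (EuclideanSpace ℝ (Fin 3) → EuclideanSpace ℝ (Fin 3)) → EuclideanSpace ℝ (Fin 3) → ℝ) (𝓑 : (Fin N → ℝ) → (EuclideanSpace ℝ (Fin 3) → EuclideanSpace ℝ (Fin 3)) → Fin N → ℝ), GateSpec N Γ κ C₂ α D U0 𝓚 𝓠 𝓑 := by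
  constructor
  · intro h N δ ρ K Λ a b cnd η Rw Rb cg θ₀ hN hδ hρ ha hη hRw hRb hcg hθ₀ Cs
    obtain ⟨κ, C₂, k₀, hk⟩ := h N δ ρ K Λ a b cnd η Rw Rb cg θ₀ hN hδ hρ ha hη hRw hRb hcg hθ₀ Cs
    obtain ⟨Γ₁, hΓ₁⟩ := hk (max k₀ 1) (le_max_left _ _) (le_max_right _ _) 1
    exact ⟨κ, C₂, max k₀ 1, Γ₁, hΓ₁⟩
  · intro h N δ ρ K Λ a b cnd η Rw Rb cg θ₀ hN hδ hρ ha hη hRw hRb hcg hθ₀ Cs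
    obtain ⟨κ, C₂, k₀, Γ₁, hΓ₁⟩ := h N δ ρ K Λ a b cnd η Rw Rb cg θ₀ hN hδ hρ ha hη hRw hRb hcg hθ₀ Cs
    refine ⟨κ, C₂, k₀ + 1, fun k hk _ Cr => ⟨max (max Γ₁ 1) Cr, ?_⟩⟩
    intro Γ hΓ γ α X w c m n u v A T D hu hv hA hT hD hbox U0 P0 b0 hbase
    have hΓ1 : 1 ≤ Γ := ((le_max_right _ _).trans (le_max_left _ _)).trans hΓ
    have hΓCr : Cr ≤ Γ := (le_max_right _ _).trans hΓ
    exact hΓ₁ Γ (((le_max_left _ _).trans (le_max_left _ _)).trans hΓ) γ α X w c m n u v A T D hu hv hA hT hD hbox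
      U0 P0 b0 (hbase.order_drop_unit hΓ1 hΓCr hk)

/-- **Thresholds may be enlarged**: in the normal form the quadruple `(κ, C₂, k₀, Γ₁)` can be replaced by any
`(κ, C₂, k₀', Γ₁')` with `k₀ ≤ k₀'`, `max Γ₁ 1 ≤ Γ₁'` (bases of order `k₀'` are bases of order `k₀` at `Γ ≥ 1`, unit
constant kept: `BaseSpec.of_order_le`).  Recorded for S2′ provers who fix `k₀` late. -/
theorem BaseSpec.unit_of_order_le {N : ℕ} {Γ ρ η Rw : ℝ} {k₀ k₀' : ℕ} {Cs : ℝ} {α : (Fin N → ℝ) → ℝ}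
    {X : (Fin N → ℝ) → Fin N → ℝ → EuclideanSpace ℝ (Fin 3)}
    {u : (Fin N → ℝ) → (Fin N → ℝ → EuclideanSpace ℝ (Fin 3)) → EuclideanSpace ℝ (Fin 3) → EuclideanSpace ℝ (Fin 3)}
    {D : (Fin N → ℝ) → Fin N → EuclideanSpace ℝ (Fin 3) → EuclideanSpace ℝ (Fin 3)}
    {U0 : (Fin N → ℝ) → EuclideanSpace ℝ (Fin 3) → EuclideanSpace ℝ (Fin 3)} {P0 : (Fin N → ℝ) → EuclideanSpace ℝ (Fin 3) → ℝ}
    {b0 : (Fin N → ℝ) → Fin N → ℝ} (h : BaseSpec N Γ ρ η Rw k₀' Cs 1 α X u D U0 P0 b0)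
    (hΓ : 1 ≤ Γ) (hk : k₀ ≤ k₀') :
    BaseSpec N Γ ρ η Rw k₀ Cs 1 α X u D U0 P0 b0 :=
  h.of_order_le hΓ hk

end Summit.NavierStokesRegularity.NavierStokesRegularity.Theorems.KelvinGate
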